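import Summits.Parity.BatemanHorn.Theses.HurwitzTauber
import Summits.Parity.BatemanHorn.Theorems.IsogenyRedeiLambdaToCount

/-!
# Birth skeleton (BC3) for crux `HurwitzTauber.FrameToBH` (stmt-Parity-19025)

Route `route-Parity-HurwitzTauber` (Bateman–Horn in the Dirichlet mean). The crux is FIXED and is
concluded BY NAME by `FrameToBH_of` below:

  `FrameToBH : ∀ BH-systems f, LogMobiusTail_f → RootHurwitzLaw_f → SlowDecrease_f → BatemanHornAsymptotic f`

(the three per-system crux conclusions of the route imply Bateman–Horn for that system).

NOTE ON THE WORKFILE PATH. The crux directory `Cruxes/FrameToBH/` is shared (by short decl name) with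
the crux `LambertRoots.FrameToBH` (stmt-Parity-16330), whose registered skeleton already occupies
`Lines/birth.lean`; this skeleton is therefore published as `Lines/birth_HurwitzTauber.lean` so as not
to overwrite another route's registered line.

## The line: Abel mean (exact Hurwitz frame) → Karamata (log mean) → Schmidt (Cesàro mean) → count

Write `a(n) = ∏ᵢ Λ(fᵢ(n)) ≥ 0` and `D_f(σ) = Σ_n a(n) n^(−σ)` (σ > 1).  KERNEL-CHECKED here (the
composition `frameToBH_of_parts`, no `sorry`):

1. **Abel mean.** `PolarPart` gives, for σ > 1, the exact termwise identity
   `D_f(σ) = (−1)^k (ΣT(σ,·) + ΣP(σ,·) + ΣRm(σ,·))` and `(σ−1)ΣP − S(σ) → 0`; `SingularSeriesAbel` gives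
   `C > 0` with `HasBatemanHornConst f C` and `(−1)^k S(σ) → C`; the crux hypotheses `LogMobiusTail_f`,
   `RootHurwitzLaw_f` give `(σ−1)ΣT → 0`, `(σ−1)ΣRm → 0`.  Limit algebra (`abel_limit_of_pieces`):
   `(σ−1)D_f(σ) = (−1)^k[(σ−1)ΣT + ((σ−1)ΣP − S) + (σ−1)ΣRm] + (−1)^k S → (−1)^k·0 + C = C` as `σ → 1⁺`.
2. **Logarithmic mean.** `KaramataLog` (Hardy–Littlewood 1914 / Karamata; MV2007 Thm 5.11, β = 1) with
   `b = a ≥ 0`, the summability from `PolarPart` and step 1: `Σ_(n≤x) a(n)/n ~ C log x`.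
3. **Cesàro mean.** `SchmidtScales` (Schmidt 1925 / Móricz 2013 Cor. 3) with `LambdaUpperBound`
   (`Σ_(n≤x) a(n) ≤ Bx`), step 2 and the crux hypothesis `SlowDecrease_f`: `Σ_(n≤x) a(n) / x → C`.
4. **Count.** `C > 0` turns the ratio limit into `Σ_(n≤x) a(n) ~ C x` (`isEquivalent_of_tendsto_div`),
   and `LambdaToCount` — discharged by the TREE theorem
   `Summit.Parity.BatemanHorn.LambdaToCount.lambdaToCount_proof` (stmt-Parity-0874, verbatim the route
   support stmt-Parity-16283) — gives `BatemanHornAsymptotic f`.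

## The registered stubs (= the five OPEN support items of the route, BY NAME)

Each stub is literally a route support decl, so proving the stub and closing the item are the same
act (`theorem … : Summit.Parity.BatemanHorn.Theses.HurwitzTauber.<Decl>` in
`Summits/Parity/BatemanHorn/Theorems/…`, `--supports stmt-Parity-19025` / `--workitem <item>`):

* `stub_singularSeriesAbel` = `SingularSeriesAbel` (stmt-Parity-19026, size L, HARDEST): Abelian
  evaluation of the complete log-weighted singular series, `(−1)^k S(σ) → C(f)` with
  `HasBatemanHornConst f C`, `C > 0` (multivariable Euler product; prime ideal theorem / Mertens in the
  splitting fields; Conrad 2003 Thm 7).  The only stub that knows the sign and the value `C(f)`.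
* `stub_polarPart` = `PolarPart` (stmt-Parity-19027, size M): the exact three-piece decomposition
  `Σ a(n)n^(−σ) = (−1)^k(ΣT + ΣP + ΣRm)` (Λ = −(μ·log) ∗ 1 per coordinate; `n^(−σ) = [n ≤ L]n^(−σ) +
  [L < n](class average + δ_σ)`) and the polar class sum `(σ−1)ΣP − S(σ) → 0` (telescoping per class).
* `stub_lambdaUpperBound` = `LambdaUpperBound` (stmt-Parity-19028, size M): Brun–Selberg upper bound
  `Σ_(n≤x) ∏Λ(fᵢ(n)) ≤ Bx`.
* `stub_karamataLog` = `KaramataLog` (stmt-Parity-19029, size S–M, provable now from the tree theorem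
  `Literature.NumberTheory.LFunctions.MontgomeryVaughan2007_5_11_holds` / `.log_of_nonneg`).
* `stub_schmidtScales` = `SchmidtScales` (stmt-Parity-19030, size M: Schmidt's Tauberian theorem for the
  logarithmic method; Móricz 2013 Cor. 3 = Kwee 1967 Lemma 3, vendored as the Literature fact
  `Moricz2013_cor3_logSummable_slowlyDecreasing`, plus partial summation).

`FrameToBH_of : FrameToBH := frameToBH_of_parts stub₁ … stub₅ lambdaToCount_proof` concludes the crux
BY NAME; its axiom closure contains `sorryAx` exactly through the five `stub_*`.

Disproof used: none exists for this crux (`ledger crux ls stmt-Parity-19025`: no `Disproof.lean`, no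
`_false_without_` theorem, no landed `Theorems/FrameToBH/Negative/*`; `ledger negatives --problem
Parity` has no statement of this shape).  The refuter's birth attack (rattack-stmt-Parity-19025)
records: S → C provable (the crux is a consequence of BH — expected for a frame), k = 0 slice TRUE
(Degenerate.lean), normalisation of `C(f)` in `SingularSeriesAbel` checked correct.
-/

namespace Summit.Parity.BatemanHorn.Cruxes.FrameToBH.BirthHurwitzTauber

open scoped BigOperators Topology Classical
open Filter Asymptotics
open Summit.Parity.BatemanHorn.Theses.HurwitzTauber (FrameToBH SingularSeriesAbel PolarPart
  LambdaUpperBound KaramataLog SchmidtScales LambdaToCount)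

set_option linter.unusedVariables false

/-! ## The stubs -/

/-- **Stub 1 — `stub_singularSeriesAbel`** = route support `SingularSeriesAbel` (stmt-Parity-19026;
theorem-grade, size L, HARDEST).  For every Bateman–Horn system `f`: with
`S(σ,d) = (∏ᵢ μ(dᵢ) log dᵢ) · |R(d)| · lcm(d)^(−σ)` (`R(d)` = joint root classes mod `lcm d`), there is
`C > 0` with `HasBatemanHornConst f C`, `Σ_d S(σ,d)` absolutely summable for `σ > 1`, and
`(−1)^k Σ_d S(σ,d) → C` as `σ → 1⁺` (Abel's theorem for the multivariable Dirichlet series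
`∏_p (1 − ω_f(p) p^(−s)) ζ(s)^k`-type Euler product; Mertens / prime ideal theorem for each `fᵢ`).
[Conrad2003HardyLittlewoodConstants, BatemanHornMathComp1962] -/
theorem stub_singularSeriesAbel :
    Summit.Parity.BatemanHorn.Theses.HurwitzTauber.SingularSeriesAbel := by
  sorry

/-- **Stub 2 — `stub_polarPart`** = route support `PolarPart` (stmt-Parity-19027; size M).  For every
Bateman–Horn system and `σ > 1`: all pieces summable, the exact termwise identity
`Σ_n ∏Λ(fᵢ(n)) n^(−σ) = (−1)^k (Σ_n T + Σ_n P + Σ_n Rm)` and the polar class sum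
`(σ−1) Σ_n P(σ,n) − Σ_d S(σ,d) → 0` (per residue class the averages telescope to `L^(−σ)/(σ−1)`).
[Korevaar2004, MontgomeryVaughan2007] -/
theorem stub_polarPart :
    Summit.Parity.BatemanHorn.Theses.HurwitzTauber.PolarPart := by
  sorry

/-- **Stub 3 — `stub_lambdaUpperBound`** = route support `LambdaUpperBound` (stmt-Parity-19028; size M).
Brun–Selberg upper bound `Σ_(n≤x) ∏ᵢ Λ(fᵢ(n)) ≤ B·x` for all `x`.
[BatemanHornMathComp1962, Tenenbaum2015] -/
theorem stub_lambdaUpperBound :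
    Summit.Parity.BatemanHorn.Theses.HurwitzTauber.LambdaUpperBound := by
  sorry

/-- **Stub 4 — `stub_karamataLog`** = route support `KaramataLog` (stmt-Parity-19029; size S–M,
provable now).  Hardy–Littlewood (1914) / Karamata Tauberian theorem for Dirichlet series with
non-negative coefficients, logarithmic conclusion (`β = 1` of Montgomery–Vaughan Thm 5.11, in the tree
as `Literature.NumberTheory.LFunctions.MontgomeryVaughan2007_5_11_holds`).
[HardyLittlewood1914, MontgomeryVaughan2007] -/
theorem stub_karamataLog :
    Summit.Parity.BatemanHorn.Theses.HurwitzTauber.KaramataLog := by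
  sorry

/-- **Stub 5 — `stub_schmidtScales`** = route support `SchmidtScales` (stmt-Parity-19030; size M).
Schmidt-type Tauberian theorem for the logarithmic method: `b ≥ 0`, `Σ_(n≤x) b(n) ≤ Bx`, logarithmic
mean value `C` and one-sided slow decrease of `x⁻¹Σ_(n≤x) b(n)` on the scales `x → x^(1+δ)` give the
mean value `C` (Móricz 2013 Cor. 3 / Kwee 1967 Lemma 3 in `u = log x`, plus partial summation).
[Schmidt1925, Korevaar2004, Moricz2013] -/
theorem stub_schmidtScales :
    Summit.Parity.BatemanHorn.Theses.HurwitzTauber.SchmidtScales := by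
  sorry

/-! ## Kernel-checked pieces -/

/-- **Abel-mean limit algebra.**  If `D(σ) = (−1)^k (T(σ) + P(σ) + R(σ))` for `σ > 1`,
`(σ−1)T(σ) → 0`, `(σ−1)P(σ) − S(σ) → 0`, `(σ−1)R(σ) → 0` and `(−1)^k S(σ) → C` as `σ → 1⁺`, then
`(σ−1)D(σ) → C`. -/
theorem abel_limit_of_pieces (k : ℕ) (D T P R S : ℝ → ℝ) (C : ℝ)
    (hid : ∀ σ : ℝ, 1 < σ → D σ = (-1 : ℝ) ^ k * (T σ + P σ + R σ))
    (hT : Tendsto (fun σ : ℝ => (σ - 1) * T σ) (𝓝[>] 1) (𝓝 0))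
    (hP : Tendsto (fun σ : ℝ => (σ - 1) * P σ - S σ) (𝓝[>] 1) (𝓝 0))
    (hR : Tendsto (fun σ : ℝ => (σ - 1) * R σ) (𝓝[>] 1) (𝓝 0))
    (hS : Tendsto (fun σ : ℝ => (-1 : ℝ) ^ k * S σ) (𝓝[>] 1) (𝓝 C)) :
    Tendsto (fun σ : ℝ => (σ - 1) * D σ) (𝓝[>] 1) (𝓝 C) := by
  have hlim : Tendsto (fun σ : ℝ => (-1 : ℝ) ^ k * ((σ - 1) * T σ + ((σ - 1) * P σ - S σ) +
      (σ - 1) * R σ) + (-1 : ℝ) ^ k * S σ) (𝓝[>] 1) (𝓝 ((-1 : ℝ) ^ k * (0 + 0 + 0) + C)) :=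
    (((hT.add hP).add hR).const_mul ((-1 : ℝ) ^ k)).add hS
  simp only [add_zero, mul_zero, zero_add] at hlim
  refine hlim.congr' ?_
  filter_upwards [self_mem_nhdsWithin] with σ hσ
  rw [hid σ hσ]
  ring

/-- **Ratio limit ⇒ asymptotic equivalence** (`C ≠ 0`): `u(x)/x → C` gives `u ~ C·x`. -/
theorem isEquivalent_of_tendsto_div (u : ℕ → ℝ) (C : ℝ) (hC : C ≠ 0)
    (h : Tendsto (fun x : ℕ => u x / (x : ℝ)) atTop (𝓝 C)) :
    IsEquivalent atTop u (fun x : ℕ => C * (x : ℝ)) := by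
  refine isEquivalent_of_tendsto_one ?_
  have h1 : Tendsto (fun x : ℕ => u x / (x : ℝ) / C) atTop (𝓝 (C / C)) := h.div_const C
  rw [div_self hC] at h1
  refine h1.congr' (Eventually.of_forall fun x => ?_)
  show u x / (x : ℝ) / C = u x / (C * (x : ℝ))
  rw [div_div, mul_comm (x : ℝ) C]

/-- `0 ≤ ∏ᵢ Λ(fᵢ(n))`. -/
theorem lambdaProd_nonneg {k : ℕ} (f : Fin k → Polynomial ℤ) (n : ℕ) :
    0 ≤ ∏ i, ArithmeticFunction.vonMangoldt (((f i).eval (n : ℤ)).toNat) :=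
  Finset.prod_nonneg fun i _ => ArithmeticFunction.vonMangoldt_nonneg

/-! ## Composition (REAL proof): the five support STATEMENTS + `LambdaToCount` imply the crux BODY -/

/-- **Composition in hypothesis form.**  `SingularSeriesAbel`, `PolarPart`, `LambdaUpperBound`,
`KaramataLog`, `SchmidtScales` and `LambdaToCount` imply the body of `HurwitzTauber.FrameToBH`
(Abel mean → logarithmic mean → Cesàro mean → count, as in the module docstring). -/
theorem frameToBH_of_parts (hS : SingularSeriesAbel) (hP : PolarPart) (hB : LambdaUpperBound)
    (hK : KaramataLog) (hSch : SchmidtScales) (hL : LambdaToCount) :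
    ∀ (k : ℕ) (f : Fin k → Polynomial ℤ), Literature.NumberTheory.Sieve.IsBatemanHornSystem f → (let T : ℝ → ℕ → ℝ := fun σ n => (n : ℝ) ^ (-σ) * ∑ d ∈ (Fintype.piFinset (fun i => (((f i).eval (n : ℤ)).toNat).divisors)).filter (fun d => n ≤ Finset.univ.lcm d), ∏ i, ((ArithmeticFunction.moebius (d i) : ℝ) * Real.log (d i)); (∀ σ : ℝ, 1 < σ → Summable (T σ)) ∧ Filter.Tendsto (fun σ : ℝ => (σ - 1) * ∑' n : ℕ, T σ n) (nhdsWithin 1 (Set.Ioi 1)) (nhds 0)) → (let R : ℝ → ℕ → ℝ := fun σ n => ∑ d ∈ (Fintype.piFinset (fun i => (((f i).eval (n : ℤ)).toNat).divisors)).filter (fun d => Finset.univ.lcm d < n), (∏ i, ((ArithmeticFunction.moebius (d i) : ℝ) * Real.log (d i))) * ((n : ℝ) ^ (-σ) - ((((Finset.univ.lcm d : ℕ) : ℝ) * ((((n - 1) / Finset.univ.lcm d : ℕ) : ℝ) + 1)) ^ (1 - σ) - (((Finset.univ.lcm d : ℕ) : ℝ) * (((n - 1) / Finset.univ.lcm d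 : ℕ) : ℝ)) ^ (1 - σ)) / ((1 - σ) * ((Finset.univ.lcm d : ℕ) : ℝ))); (∀ σ : ℝ, 1 < σ → Summable (R σ)) ∧ Filter.Tendsto (fun σ : ℝ => (σ - 1) * ∑' n : ℕ, R σ n) (nhdsWithin 1 (Set.Ioi 1)) (nhds 0)) → (∀ ε : ℝ, 0 < ε → ∃ δ : ℝ, 0 < δ ∧ ∃ N₀ : ℕ, ∀ N N' : ℕ, N₀ ≤ N → N ≤ N' → (N' : ℝ) ≤ (N : ℝ) ^ (1 + δ) → (∑ n ∈ Finset.Icc 1 N, ∏ i, ArithmeticFunction.vonMangoldt (((f i).eval (n : ℤ)).toNat)) / N - ε ≤ (∑ n ∈ Finset.Icc 1 N', ∏ i, ArithmeticFunction.vonMangoldt (((f i).eval (n : ℤ)).toNat)) / N') → Literature.NumberTheory.Sieve.BatemanHornAsymptotic f := by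
  intro k f hf hT hR hSlow
  -- the route's pieces at `f`
  obtain ⟨C, hC, hBH, hSsum, hSlim⟩ := hS k f hf
  obtain ⟨hPσ, hPlim⟩ := hP k f hf
  obtain ⟨hT1, hT2⟩ := hT
  obtain ⟨hR1, hR2⟩ := hR
  -- Step 1: the Abel mean `(σ−1) D_f(σ) → C` (exact identity + the two vanishing limits + singular series)
  have habel : Tendsto (fun σ : ℝ => (σ - 1) * ∑' n : ℕ,
      (∏ i, ArithmeticFunction.vonMangoldt (((f i).eval (n : ℤ)).toNat)) * (n : ℝ) ^ (-σ))
      (nhdsWithin 1 (Set.Ioi 1)) (nhds C) :=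
    abel_limit_of_pieces k _ _ _ _ _ C (fun σ hσ => (hPσ σ hσ).2.2.2.2.2) hT2 hPlim hR2 hSlim
  -- Step 2: the logarithmic mean (Hardy–Littlewood / Karamata)
  have hlog : Tendsto (fun x : ℕ => (∑ n ∈ Finset.Icc 1 x,
      (∏ i, ArithmeticFunction.vonMangoldt (((f i).eval (n : ℤ)).toNat)) / n) / Real.log x)
      atTop (nhds C) :=
    hK (fun n => ∏ i, ArithmeticFunction.vonMangoldt (((f i).eval (n : ℤ)).toNat))
      (fun n => lambdaProd_nonneg f n) C (fun σ hσ => (hPσ σ hσ).1) habel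
  -- Step 3: the Cesàro mean (Schmidt: upper bound + log mean + slow decrease)
  have hces : Tendsto (fun x : ℕ => (∑ n ∈ Finset.Icc 1 x,
      ∏ i, ArithmeticFunction.vonMangoldt (((f i).eval (n : ℤ)).toNat)) / x) atTop (nhds C) :=
    hSch (fun n => ∏ i, ArithmeticFunction.vonMangoldt (((f i).eval (n : ℤ)).toNat))
      (fun n => lambdaProd_nonneg f n) (hB k f hf) C hlog hSlow
  -- Step 4: `C > 0` ⇒ `Σ_(n≤x) ∏Λ(fᵢ(n)) ~ C x`, then Λ → count (`LambdaToCount`)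
  have hequiv : IsEquivalent atTop
      (fun x : ℕ => ∑ n ∈ Finset.Icc 1 x, ∏ i, ArithmeticFunction.vonMangoldt (((f i).eval (n : ℤ)).toNat))
      (fun x : ℕ => C * (x : ℝ)) :=
    isEquivalent_of_tendsto_div _ C hC.ne' hces
  exact hL k f hf C hC hBH hequiv

/-- **The line concludes the crux BY NAME** (the `#h21_check_skeleton` theorem): the five registered
stubs and the tree theorem `lambdaToCount_proof` (stmt-Parity-0874 = route support `LambdaToCount`,
stmt-Parity-16283, verbatim), fed to `frameToBH_of_parts`, give
`Summit.Parity.BatemanHorn.Theses.HurwitzTauber.FrameToBH`.  No `sorry` of its own; its axiom closure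
contains `sorryAx` exactly through the five `stub_*`. -/
theorem FrameToBH_of : FrameToBH :=
  frameToBH_of_parts stub_singularSeriesAbel stub_polarPart stub_lambdaUpperBound stub_karamataLog
    stub_schmidtScales Summit.Parity.BatemanHorn.LambdaToCount.lambdaToCount_proof

end Summit.Parity.BatemanHorn.Cruxes.FrameToBH.BirthHurwitzTauber
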